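import Mathlib.Analysis.Fourier.AddCircle
import Mathlib.Analysis.SpecialFunctions.Log.Basic
import Mathlib.Analysis.SpecialFunctions.Pow.Real
import Mathlib.MeasureTheory.Function.LpSeminorm.Basic
import HarnessLib

/-!
# Weissler's logarithmic Sobolev inequality on the circle

Topic `Literature/Analysis/FunctionSpaces` (functional inequalities; torus calculus). One NAMED
FACT (`def … : Prop`, D-0014; printed theorem, unproved in the tree), filed while grounding route
`AtomisticToContinuum/BoseEinsteinCondensation/BECCellInformation`: it is the analytic input
("logarithmic Sobolev inequality for Lebesgue measure on a cube of side `s` with constant `c₀ s²`: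
Weissler's circle LSI + even reflection + tensorisation") of the support item
`Summit.AtomisticToContinuum.BoseEinsteinCondensation.Theses.BECCellInformation.TwoScaleReduction`
(`stmt-AtomisticToContinuum-13443`) and of the fine part of the crux
`Summit.AtomisticToContinuum.BoseEinsteinCondensation.Theses.BECCellInformation.OneBodyEntropyBound`
(`stmt-AtomisticToContinuum-13440`).

## What is printed, and where (read on the fetched copy of [Weissler1980], J. Funct. Anal. 37)

* §0, conventions: "`∫ f` means `(2π)⁻¹ ∫₀^{2π} f(θ) dθ` … We write `Lᵖ` for `Lᵖ(dθ/2π)` and the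
  norm `‖·‖_p` is always taken with respect to `dθ/2π` on `[0, 2π]`."
* §1, **Theorem 1**, inequality (1.1): for every `f(θ) = ∑ₙ aₙ e^{inθ}` in `L²`, non-negative,
  with `∑ₙ |n| |aₙ|² < ∞`,

    `∫ f² log f ≤ ∑ₙ |n| |aₙ|² + ‖f‖₂² log ‖f‖₂`.                                  (1.1)

  (proved first for strictly positive trigonometric polynomials, then by an approximate identity
  and Fatou; restated in §1 as (1.12) for `Q_k * f` and in §2 as "Theorem 1 applied to `f^{s/2}`
  says `∫ fˢ log f^{s/2} ≤ (H f^{s/2}, f^{s/2}) + ‖f^{s/2}‖₂² log ‖f^{s/2}‖₂`", where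
  `(Hf)(θ) = ∑ₙ |n| aₙ e^{inθ}`, `(Hf, f) = ∑ₙ |n| |aₙ|²`, `H = (-d²/dθ²)^{1/2}` generates the
  Poisson semigroup).
* Consequence used downstream (not part of the vendored statement): `|n| ≤ n²` and Parseval
  `∑ₙ n² |aₙ|² = ‖f'‖₂²` give the heat-semigroup form `∫ f² log f - ‖f‖₂² log ‖f‖₂ ≤ ‖f'‖₂²`, i.e.
  `Ent_{dθ/2π}(f²) ≤ 2 ∫ |f'|² dθ/2π` — Gross's inequality with the Gaussian constant, optimal on the
  circle (§0: test functions `1 + a sin θ`); even reflection and the product property of LSI then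
  give `Ent_{u_Q}(f²) ≤ (2s²/π²) ∫_Q |∇f|² du_Q` on a cube `Q` of side `s`.

## Vendored form

Mathlib's `AddCircle T` with its Haar probability measure `AddCircle.haarAddCircle` and
`fourierCoeff f n = ∫ (fourier (-n) θ) • f θ ∂haarAddCircle` (`fourier n θ = e^{2πinθ/T}`) is, for
`T = 2π`, exactly Weissler's circle, normalised measure and coefficient `aₙ`. Both sides of (1.1)
are built from the normalised measure and the Fourier coefficients only, so (1.1) is invariant
under the reparametrisation `θ ↦ 2πθ/T`; it is therefore stated for every period `T > 0`.
Conventions: `Real.log 0 = 0` matches `0² log 0 = 0`; `‖f‖₂ = √(∫ f²)`; `f` real-valued and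
`≥ 0` pointwise, viewed in `ℂ` for `fourierCoeff`.

## References

* [Weissler1980] F. B. Weissler, *Logarithmic Sobolev inequalities and hypercontractive estimates
  on the circle*, J. Funct. Anal. 37 (1980) 218–234, doi:10.1016/0022-1236(80)90042-7: §1 Thm. 1
  (1.1); §2 (the operator `H`); §3 (3.3) (the improved inequality, not vendored).
-/

namespace Literature.Analysis.FunctionSpaces

open MeasureTheory

/-- **Weissler's logarithmic Sobolev inequality on the circle.** For `f ≥ 0` in `L²(dθ/2π)` with
Fourier coefficients `aₙ` such that `∑ₙ |n| |aₙ|² < ∞`: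
`∫ f² log f ≤ ∑ₙ |n| |aₙ|² + ‖f‖₂² log ‖f‖₂` (normalised Haar measure of the circle of period `T`;
printed for `T = 2π`, reparametrisation-invariant). Grounds
`Summit.AtomisticToContinuum.BoseEinsteinCondensation.Theses.BECCellInformation.TwoScaleReduction`
and `Summit.AtomisticToContinuum.BoseEinsteinCondensation.Theses.BECCellInformation.OneBodyEntropyBound`
(cube LSI `Ent_{u_Q}(f²) ≤ (2s²/π²)∫|∇f|² du_Q` by `|n| ≤ n²`, reflection and tensorisation).
[cite: Weissler1980, §1 Thm 1 (1.1)] -/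
def Weissler1980_circle_logSobolev : Prop :=
  ∀ (T : ℝ) [Fact (0 < T)] (f : AddCircle T → ℝ),
    (∀ θ, 0 ≤ f θ) → MemLp f 2 AddCircle.haarAddCircle →
    Summable (fun n : ℤ => |(n : ℝ)| * ‖fourierCoeff (fun θ => (f θ : ℂ)) n‖ ^ 2) →
    ∫ θ, f θ ^ 2 * Real.log (f θ) ∂AddCircle.haarAddCircle ≤
      (∑' n : ℤ, |(n : ℝ)| * ‖fourierCoeff (fun θ => (f θ : ℂ)) n‖ ^ 2) +
        (∫ θ, f θ ^ 2 ∂AddCircle.haarAddCircle) *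
          Real.log (Real.sqrt (∫ θ, f θ ^ 2 ∂AddCircle.haarAddCircle))


end Literature.Analysis.FunctionSpaces
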